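import Summits.AnomalousDissipation.AnomalousDissipation.Theorems.TwohalfdThesis.Negative.DescentWeak
import Literature.Analysis.FluidPDE.DoeringFoiasPowerProofs
import Literature.Analysis.FluidPDE.PassiveScalarProofs

/-!
# Negative knowledge for the crux `TwohalfdThesis` (stmt-AnomalousDissipation-0206), V: descent of the weak formulation of an
# `x₃`-invariant Navier–Stokes solution to its SCALAR part — the sourced transport–diffusion equation for `u₃`

Second instalment (after `Negative/DescentWeak.lean`, the planar part) of the bookkeeping half of the gap `PlanarDescentEnergyEq`
(`Literature.Analysis.FluidPDE.PlanarDescentEnergyEq`; cdisprove work file `Descent.lean`, route `TwoAndHalfD`).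

* `Descent.isWeakScalarTransportForcedOn_verticalPart` — **if `u` is an `x₃`-invariant weak (pressure-free) Navier–Stokes
  solution on `T³ × [0,T)` with force `(g,h)∘π`, `x₃`-invariant datum, `L²` slices on `[0,T]` and a uniform `L²` bound on the
  slices on `(0,T)` (all available for Leray–Hopf solutions), then its vertical part `w = u₃(·,·,0)` is a weak solution on
  `T² × [0,T)` of the SOURCED transport–diffusion equation `∂ₜw + v·∇w = νΔw + h` driven by the planar part `v`
  (`Torus.IsWeakScalarTransportForcedOn T ν v (fun _ => h) w₀ w`), i.e. exactly the scalar equation of crux #2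
  `ScalarAnomalySteadySourceFormal`** (Majda–Bertozzi 2002 §2.3.1; Bardos–Lopes Filho–Niu–Nussenzveig Lopes–Titi 2013 §2):
  test the 3-D identity with the vertical lift `(0,φ)∘π` of a scalar test function (`isSpaceTimeTest_twoHalf_zero_left`,
  `isDivFreeTest_twoHalf_zero_left`, `timeDeriv_vlift`) and descend term by term (`integral_inner_vlift`,
  `integral_inner_convect_vlift` — the planar convective pairing `⟪v,(v·∇)0⟫` vanishes and `w ⟪v,∇φ⟫` remains —,
  `integral_inner_laplacian_vlift`, `integral_inner_force_vlift`); the `L^∞L²`, `L¹L²`, `L¹_{t,x}` clauses of the scalar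
  notion come from the slice bounds (`lintegral_enorm_mul_parts_le`: `∫‖v‖|w| ≤ 2∫‖u‖²`).
Together with `DescentWeak`: an `x₃`-invariant weak NS solution IS a planar weak NS solution plus a weakly transported, sourced
third component — the formal core of the route's kill criterion "X ⇒ #2".  What remains of the gap: the Leray–Hopf energy
clauses of the planar part (the analytic half).  Supports stmt-AnomalousDissipation-0206.
-/

noncomputable section

namespace Summit.AnomalousDissipation.AnomalousDissipation.Theorems.TwohalfdThesis.Negative.Descent

open MeasureTheory Set Filter Topology UnitAddTorus Function
open scoped ENNReal NNReal InnerProductSpace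
open Literature.Analysis.FunctionSpaces Literature.Analysis.FunctionSpaces.Torus
open Literature.Analysis.FluidPDE Literature.Analysis.FluidPDE.Torus
open Summit.AnomalousDissipation.AnomalousDissipation.Theorems.TwohalfdNeg.Negative

/-- Local notation: the flat unit three-torus. -/
local notation "𝕋³" => UnitAddTorus (Fin 3)
/-- Local notation: velocity values on `T³`. -/
local notation "E³" => EuclideanSpace ℝ (Fin 3)
/-- Local notation: the flat unit two-torus. -/
local notation "𝕋²" => UnitAddTorus (Fin 2)
/-- Local notation: velocity values on `T²`. -/
local notation "E²" => EuclideanSpace ℝ (Fin 2)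

/-! ## Part A2 preliminaries: the vertical lift `(0, φ)∘π` of a scalar test function -/

section VerticalLift

variable {T : ℝ} {φ : ℝ → 𝕋² → ℝ} {U : 𝕋³ → E³}

/-- **Lift of scalar test functions**: `t ↦ (0, φ t)∘π` is a space–time test field on `T³`. [folklore] -/
theorem isSpaceTimeTest_twoHalf_zero_left (hφ : IsSpaceTimeTest T φ) :
    IsSpaceTimeTest T (fun t => twoHalf (0 : 𝕋² → E²) (φ t)) := by
  obtain ⟨hs, T', hT', h0⟩ := hφ
  refine ⟨?_, T', hT', fun t ht => ?_⟩
  · have h1 : Torus.IsSmoothSpaceTimeOn univ φ := by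
      unfold Torus.IsSmoothSpaceTimeOn
      rw [Set.univ_prod_univ]
      exact hs.contDiffOn
    have h2 : Torus.IsSmoothSpaceTimeOn univ (fun (_ : ℝ) => (0 : 𝕋² → E²)) :=
      isSmoothSpaceTimeOn_const isSmooth_zero₂ _
    have h3 := h2.twoHalf h1
    unfold Torus.IsSmoothSpaceTimeOn at h3
    rw [Set.univ_prod_univ] at h3
    exact contDiffOn_univ.1 h3
  · funext x
    show twoHalf 0 (φ t) x = 0
    rw [h0 t ht]
    simp only [twoHalf, Pi.zero_apply]
    exact (map_zero planarEmbed : planarEmbed ((0 : E²), (0 : ℝ)) = 0)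

/-- The vertical lift is divergence free (`div (0,φ)∘π = (div 0)∘π = 0`). [folklore] -/
theorem isDivFreeTest_twoHalf_zero_left (φ : ℝ → 𝕋² → ℝ) :
    IsDivFreeTest (fun t => twoHalf (0 : 𝕋² → E²) (φ t)) := fun _ =>
  IsDivFree.twoHalf (isDivFree_fun_const (0 : E²)) _

/-- **`∂ₜ((0,φ)∘π) = (0, ∂ₜφ)∘π`.** [folklore] -/
theorem timeDeriv_vlift (hφ : IsSpaceTimeTest T φ) (t : ℝ) :
    Literature.Analysis.FunctionSpaces.Torus.timeDeriv (fun τ => twoHalf (0 : 𝕋² → E²) (φ τ)) t =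
      twoHalf (0 : 𝕋² → E²) (Literature.Analysis.FunctionSpaces.Torus.timeDeriv φ t) := by
  funext x
  have hd : HasDerivAt (fun τ => φ τ (planarProj x)) (Literature.Analysis.FunctionSpaces.Torus.timeDeriv φ t (planarProj x)) t :=
    hasDerivAt_slice_timeDeriv hφ.1 t _
  have hp : HasDerivAt (fun τ => ((0 : E²), φ τ (planarProj x)))
      ((0 : E²), Literature.Analysis.FunctionSpaces.Torus.timeDeriv φ t (planarProj x)) t :=
    (hasDerivAt_const t (0 : E²)).prodMk hd
  have h := (planarEmbed.hasFDerivAt.comp_hasDerivAt t hp).deriv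
  simp only [Literature.Analysis.FunctionSpaces.Torus.timeDeriv]
  exact h

/-- **Pairing with a lifted vertical field**: `∫⟪U, (0,G)∘π⟫ = ∫ w G`. [folklore] -/
theorem integral_inner_vlift (hU : ∀ (s : UnitAddCircle) (x : 𝕋³), U (x + Pi.single (2 : Fin 3) s) = U x)
    (h2 : MemLp U 2 volume) {G : 𝕋² → ℝ} (hG : MemLp G 2 volume) :
    ∫ x, ⟪U x, twoHalf (0 : 𝕋² → E²) G x⟫_ℝ = ∫ y, verticalPart U y * G y := by
  obtain ⟨-, hR⟩ := memLp_parts hU h2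
  conv_lhs => rw [eq_twoHalf_parts hU]
  exact integral_inner_twoHalf_vertical _ hR hG

/-- **The viscous term of the vertical lift descends**: `∫⟪U, Δ((0,φ')∘π)⟫ = ∫ w Δφ'`. [folklore] -/
theorem integral_inner_laplacian_vlift (hU : ∀ (s : UnitAddCircle) (x : 𝕋³), U (x + Pi.single (2 : Fin 3) s) = U x)
    (h2 : MemLp U 2 volume) {φ' : 𝕋² → ℝ} (hφ' : IsSmooth φ') :
    ∫ x, ⟪U x, Torus.laplacian (twoHalf (0 : 𝕋² → E²) φ') x⟫_ℝ = ∫ y, verticalPart U y * Torus.laplacian φ' y := by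
  rw [laplacian_twoHalf isSmooth_zero₂ hφ']
  have h0 : Torus.laplacian (0 : 𝕋² → E²) = 0 := funext fun y => laplacian_zero₂ y
  rw [h0]
  exact integral_inner_vlift hU h2 (hφ'.laplacian.memLp 2)

/-- **The force term of the vertical lift**: `∫⟪(g,h)∘π, (0,φ')∘π⟫ = ∫ h φ'`. [folklore] -/
theorem integral_inner_force_vlift {g : 𝕋² → E²} {h : 𝕋² → ℝ} (hh : MemLp h 2 volume) {φ' : 𝕋² → ℝ}
    (hφ' : MemLp φ' 2 volume) :
    ∫ x, ⟪twoHalf g h x, twoHalf (0 : 𝕋² → E²) φ' x⟫_ℝ = ∫ y, h y * φ' y :=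
  integral_inner_twoHalf_vertical g hh hφ'

/-- **The convective term of the vertical lift descends**: `∫⟪U, (U·∇)((0,φ t)∘π)⟫ = ∫ w ⟪v, ∇(φ t)⟫`. [folklore] -/
theorem integral_inner_convect_vlift (hφ : IsSpaceTimeTest T φ) (t : ℝ)
    (hU : ∀ (s : UnitAddCircle) (x : 𝕋³), U (x + Pi.single (2 : Fin 3) s) = U x) (h2 : MemLp U 2 volume) :
    ∫ x, ⟪U x, Torus.convect U (twoHalf (0 : 𝕋² → E²) (φ t)) x⟫_ℝ =
      ∫ y, verticalPart U y * ⟪planarPart U y, Torus.gradient (φ t) y⟫_ℝ := by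
  obtain ⟨hV, hR⟩ := memLp_parts hU h2
  conv_lhs => rw [eq_twoHalf_parts hU]
  have hz : IsContDiff 1 (0 : 𝕋² → E²) := isSmooth_zero₂.isContDiff (by simp)
  have hW : IsContDiff 1 (φ t) := (hφ.isSmooth_slice t).isContDiff (by simp)
  have hc0 : ∀ y : 𝕋², Torus.convect (planarPart U) (0 : 𝕋² → E²) y = 0 := fun y =>
    convect_fun_const (planarPart U) (0 : E²) y
  have h1 : Integrable (fun y => ⟪planarPart U y, Torus.convect (planarPart U) (0 : 𝕋² → E²) y⟫_ℝ) volume := by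
    have : (fun y => ⟪planarPart U y, Torus.convect (planarPart U) (0 : 𝕋² → E²) y⟫_ℝ) = fun _ => 0 := by
      funext y
      rw [hc0 y, inner_zero_right]
    rw [this]
    exact integrable_const _
  rw [integral_inner_twoHalf_convect_eq_add hz hW h1
    (integrable_mul_inner_gradient_slice (u := fun _ => planarPart U) (w := fun _ => verticalPart U) hφ hV hR)]
  have : (∫ y, ⟪planarPart U y, Torus.convect (planarPart U) (0 : 𝕋² → E²) y⟫_ℝ) = 0 := by
    simp_rw [hc0, inner_zero_right, integral_zero]
  rw [this, zero_add]

end VerticalLift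

/-! ## Part A2: descent of the weak formulation to the SCALAR part (the sourced transport–diffusion equation) -/

section ScalarDescent

variable {T : ℝ} {u : ℝ → 𝕋³ → E³}

/-- `ab ≤ a² + b²` in `ℝ≥0∞`. [folklore] -/
theorem ennreal_mul_le_sq_add_sq (a b : ℝ≥0∞) : a * b ≤ a ^ 2 + b ^ 2 := by
  rcases le_total a b with hab | hab
  · calc a * b ≤ b * b := by gcongr
      _ = b ^ 2 := (sq b).symm
      _ ≤ a ^ 2 + b ^ 2 := le_add_self
  · calc a * b ≤ a * a := by gcongr
      _ = a ^ 2 := (sq a).symm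
      _ ≤ a ^ 2 + b ^ 2 := le_self_add

/-- **`∫ ‖v‖ |w| ≤ 2 ∫ ‖u‖²`** for the parts of an `x₃`-invariant field (no measurability needed). [folklore] -/
theorem lintegral_enorm_mul_parts_le {U : 𝕋³ → E³}
    (hU : ∀ (s : UnitAddCircle) (x : 𝕋³), U (x + Pi.single (2 : Fin 3) s) = U x) (hm : MemLp U 2 volume) :
    ∫⁻ y, ‖planarPart U y‖ₑ * ‖verticalPart U y‖ₑ ≤ 2 * ∫⁻ x, ‖U x‖ₑ ^ 2 := by
  have hV : AEMeasurable (fun y => ‖planarPart U y‖ₑ ^ 2) volume :=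
    ((memLp_parts hU hm).1.1.aemeasurable.enorm.pow_const _)
  calc ∫⁻ y, ‖planarPart U y‖ₑ * ‖verticalPart U y‖ₑ
      ≤ ∫⁻ y, (‖planarPart U y‖ₑ ^ 2 + ‖verticalPart U y‖ₑ ^ 2) := lintegral_mono fun y => ennreal_mul_le_sq_add_sq _ _
    _ = (∫⁻ y, ‖planarPart U y‖ₑ ^ 2) + ∫⁻ y, ‖verticalPart U y‖ₑ ^ 2 :=
        lintegral_add_left' hV _
    _ ≤ (∫⁻ x, ‖U x‖ₑ ^ 2) + ∫⁻ x, ‖U x‖ₑ ^ 2 := by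
        conv_rhs => rw [eq_twoHalf_parts hU]
        exact add_le_add (lintegral_enorm_sq_left_le_twoHalf _ _) (lintegral_enorm_sq_right_le_twoHalf _ _)
    _ = 2 * ∫⁻ x, ‖U x‖ₑ ^ 2 := (two_mul _).symm


/-- Measurability of the parts in the `uncurry` form used by the bookkeeping lemmas. [folklore] -/
theorem aestronglyMeasurable_uncurry_parts
    (hinv : ∀ (t : ℝ) (s : UnitAddCircle) (x : 𝕋³), u t (x + Pi.single (2 : Fin 3) s) = u t x)
    (hm : AEStronglyMeasurable (stLift u) (volume.restrict (Ioo 0 T ×ˢ univ))) :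
    AEStronglyMeasurable (uncurry fun t => planarPart (u t)) ((volume.restrict (Ioo 0 T)).prod (volume : Measure 𝕋²)) ∧
      AEStronglyMeasurable (uncurry fun t => verticalPart (u t)) ((volume.restrict (Ioo 0 T)).prod (volume : Measure 𝕋²)) := by
  have h' := aestronglyMeasurable_uncurry_of_stLift_prod hm
  rw [eq_twoHalf_parts_fun hinv] at h'
  exact ⟨aestronglyMeasurable_uncurry_of_twoHalf_left h', aestronglyMeasurable_uncurry_of_twoHalf_right h'⟩

/-- **PART A2 — DESCENT OF THE WEAK FORMULATION TO THE SCALAR PART.**  Under the hypotheses of Part A1 plus a uniform `L²`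
bound on the slices on `(0,T)` (available for Leray–Hopf solutions), the vertical part `w = u₃(·,0)` is a weak solution of the
sourced transport–diffusion equation `∂ₜw + v·∇w = νΔw + h` on `T² × [0,T)` driven by the planar part `v`, in the sense of
`Torus.IsWeakScalarTransportForcedOn` (test the 3-D identity with the vertical lift `(0, φ)∘π` of a scalar test function).
[folklore] -/
theorem isWeakScalarTransportForcedOn_verticalPart {ν : ℝ} {g : 𝕋² → E²} {h : 𝕋² → ℝ} {u₀ : 𝕋³ → E³}
    (hw : IsWeakNSSolutionForcedOn T ν (fun _ => twoHalf g h) u₀ u)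
    (hinv₀ : ∀ (s : UnitAddCircle) (x : 𝕋³), u₀ (x + Pi.single (2 : Fin 3) s) = u₀ x)
    (hinv : ∀ (t : ℝ) (s : UnitAddCircle) (x : 𝕋³), u t (x + Pi.single (2 : Fin 3) s) = u t x)
    (h2₀ : MemLp u₀ 2 volume) (h2 : ∀ t ∈ Icc 0 T, MemLp (u t) 2 volume)
    {C : ℝ} (hC : ∀ t ∈ Ioo 0 T, ∫ x, ‖u t x‖ ^ 2 ≤ C) (hg : IsSmooth g) (hh : IsSmooth h) :
    IsWeakScalarTransportForcedOn T ν (fun t => planarPart (u t)) (fun _ => h) (verticalPart u₀)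
      (fun t => verticalPart (u t)) := by
  obtain ⟨hm, hL2, hdiv, hid⟩ := hw
  have hIo : ∀ {t : ℝ}, t ∈ Ioo 0 T → t ∈ Icc 0 T := fun ht => Ioo_subset_Icc_self ht
  obtain ⟨hum, hwm⟩ := aestronglyMeasurable_uncurry_parts hinv hm
  have hmeas := aestronglyMeasurable_stLift_of_twoHalf (by rw [eq_twoHalf_parts_fun hinv] at hm; exact hm)
  have hV2 : ∀ t ∈ Ioo 0 T, MemLp (planarPart (u t)) 2 volume := fun t ht => (memLp_parts (hinv t) (h2 t (hIo ht))).1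
  have hR2 : ∀ t ∈ Ioo 0 T, MemLp (verticalPart (u t)) 2 volume := fun t ht => (memLp_parts (hinv t) (h2 t (hIo ht))).2
  -- uniform L² bounds for the parts
  have hsplit : ∀ t ∈ Ioo 0 T, (∫ y, ‖planarPart (u t) y‖ ^ 2) + (∫ y, verticalPart (u t) y ^ 2) = ∫ x, ‖u t x‖ ^ 2 := by
    intro t ht
    conv_rhs => rw [eq_twoHalf_parts (hinv t)]
    exact (integral_norm_sq_twoHalf_of_memLp (hV2 t ht) (hR2 t ht)).symm
  have hCu : ∀ t ∈ Ioo 0 T, ∫ y, ‖planarPart (u t) y‖ ^ 2 ≤ C := fun t ht => by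
    have h0 : 0 ≤ ∫ y, verticalPart (u t) y ^ 2 := integral_nonneg fun _ => sq_nonneg _
    linarith [hsplit t ht, hC t ht]
  have hCw : ∀ t ∈ Ioo 0 T, ∫ y, ‖verticalPart (u t) y‖ ^ 2 ≤ C := fun t ht => by
    have h0 : 0 ≤ ∫ y, ‖planarPart (u t) y‖ ^ 2 := integral_nonneg fun _ => sq_nonneg _
    have he : (∫ y, ‖verticalPart (u t) y‖ ^ 2) = ∫ y, verticalPart (u t) y ^ 2 :=
      integral_congr_ae (ae_of_all _ fun y => by simp [Real.norm_eq_abs, sq_abs])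
    linarith [hsplit t ht, hC t ht]
  -- the a.e. `L²` bound of the weak solution (in `ℝ≥0∞`) for the scalar part
  have hRbound : ∃ C' : ℝ≥0, ∀ᵐ t ∂(volume.restrict (Ioo 0 T)), ∫⁻ y, ‖verticalPart (u t) y‖ₑ ^ 2 ≤ C' := by
    refine ⟨C.toNNReal, (ae_restrict_mem measurableSet_Ioo).mono fun t ht => ?_⟩
    rw [Torus.lintegral_enorm_sq_eq_ofReal (hR2 t ht)]
    show ENNReal.ofReal (∫ y, ‖verticalPart (u t) y‖ ^ 2) ≤ ENNReal.ofReal C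
    exact ENNReal.ofReal_le_ofReal (hCw t ht)
  refine ⟨hmeas.2, hmeas.1, ?_, hRbound, ?_, ?_, ?_, ae_isWeaklyDivFree_planarPart hinv h2 hdiv, fun φ hφ => ?_⟩
  · -- the steady source is measurable
    exact (hh.continuous.comp (continuous_proj.comp continuous_snd)).aestronglyMeasurable
  · -- `v ∈ L¹(0,T; L²)`: slices bounded by `√(max C 0)`
    have hpt : ∀ t ∈ Ioo 0 T, (∫⁻ y, ‖planarPart (u t) y‖ₑ ^ 2) ^ (1 / 2 : ℝ) ≤ (ENNReal.ofReal (max C 0)) ^ (1 / 2 : ℝ) := by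
      intro t ht
      gcongr
      rw [Torus.lintegral_enorm_sq_eq_ofReal (hV2 t ht)]
      exact ENNReal.ofReal_le_ofReal ((hCu t ht).trans (le_max_left _ _))
    calc ∫⁻ t in Ioo 0 T, (∫⁻ y, ‖planarPart (u t) y‖ₑ ^ 2) ^ (1 / 2 : ℝ)
        ≤ ∫⁻ _ in Ioo 0 T, (ENNReal.ofReal (max C 0)) ^ (1 / 2 : ℝ) := setLIntegral_mono' measurableSet_Ioo hpt
      _ < ∞ := by
          rw [setLIntegral_const]
          exact ENNReal.mul_lt_top (ENNReal.rpow_lt_top_of_nonneg (by norm_num) ENNReal.ofReal_ne_top) measure_Ioo_lt_top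
  · -- `v w ∈ L¹_{t,x}`: `‖v‖|w| ≤ ‖v‖² + |w|² ≤ 2‖u‖²` slice-wise
    calc ∫⁻ t in Ioo 0 T, ∫⁻ y, ‖planarPart (u t) y‖ₑ * ‖verticalPart (u t) y‖ₑ
        ≤ ∫⁻ t in Ioo 0 T, 2 * ∫⁻ x, ‖u t x‖ₑ ^ 2 :=
          setLIntegral_mono' measurableSet_Ioo fun t ht => lintegral_enorm_mul_parts_le (hinv t) (h2 t (hIo ht))
      _ = 2 * ∫⁻ t in Ioo 0 T, ∫⁻ x, ‖u t x‖ₑ ^ 2 := lintegral_const_mul' _ _ (by norm_num)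
      _ < ∞ := ENNReal.mul_lt_top (by norm_num) hL2
  · -- the steady smooth source is in `L¹_{t,x}`
    have h1 : ∫⁻ y, ‖h y‖ₑ < ∞ := by
      have := (hh.memLp 1).eLpNorm_lt_top
      rwa [eLpNorm_one_eq_lintegral_enorm] at this
    calc ∫⁻ _ in Ioo 0 T, ∫⁻ y, ‖h y‖ₑ = (∫⁻ y, ‖h y‖ₑ) * volume (Ioo 0 T) := setLIntegral_const _ _
      _ < ∞ := ENNReal.mul_lt_top h1 measure_Ioo_lt_top
  · -- THE WEAK IDENTITY: test the 3-D identity with the vertical lift `(0, φ)∘π`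
    have hΦ : IsSpaceTimeTest T (fun t => twoHalf (0 : 𝕋² → E²) (φ t)) := isSpaceTimeTest_twoHalf_zero_left hφ
    have h3 := hid (fun t => twoHalf (0 : 𝕋² → E²) (φ t)) hΦ (isDivFreeTest_twoHalf_zero_left φ)
    have hF : IsSmooth (twoHalf g h) := hg.twoHalf hh
    obtain ⟨M₁, hM₁⟩ := exists_bound_of_continuous_uncurry hφ.continuous_uncurry_timeDeriv 0 T
    obtain ⟨M₂, hM₂⟩ := exists_bound_of_continuous_uncurry hφ.continuous_uncurry_laplacian 0 T
    -- slice identity: the 3-D integrand equals `∫ w(∂ₜφ + v·∇φ + νΔφ) + ∫ h φ`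
    have hslice : ∀ t ∈ Ioo 0 T,
        (∫ x, (⟪u t x, Literature.Analysis.FunctionSpaces.Torus.timeDeriv (fun t => twoHalf (0 : 𝕋² → E²) (φ t)) t x⟫_ℝ +
            ⟪u t x, Torus.convect (u t) ((fun t => twoHalf (0 : 𝕋² → E²) (φ t)) t) x⟫_ℝ +
            ν * ⟪u t x, Torus.laplacian ((fun t => twoHalf (0 : 𝕋² → E²) (φ t)) t) x⟫_ℝ +
            ⟪(fun _ : ℝ => twoHalf g h) t x, (fun t => twoHalf (0 : 𝕋² → E²) (φ t)) t x⟫_ℝ)) =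
          (∫ y, verticalPart (u t) y *
              (Literature.Analysis.FunctionSpaces.Torus.timeDeriv φ t y + ⟪planarPart (u t) y, Torus.gradient (φ t) y⟫_ℝ +
                ν * Torus.laplacian (φ t) y)) +
            ∫ y, h y * φ t y := by
      intro t ht
      have hut : MemLp (u t) 2 volume := h2 t (hIo ht)
      have hVt := hV2 t ht
      have hRt := hR2 t ht
      -- integrability, 3-D side
      have iA := integrable_inner_timeDeriv_slice (U := u) hΦ hut
      have iB := integrable_inner_convect_slice (U := u) hΦ hut
      have iC : Integrable (fun x => ν * ⟪u t x, Torus.laplacian (twoHalf (0 : 𝕋² → E²) (φ t)) x⟫_ℝ) volume :=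
        (Torus.integrable_inner_of_memLp_two hut ((hΦ.isSmooth_slice t).laplacian.memLp 2)).const_mul ν
      have iD : Integrable (fun x => ⟪twoHalf g h x, twoHalf (0 : 𝕋² → E²) (φ t) x⟫_ℝ) volume :=
        Torus.integrable_inner_of_memLp_two (hF.memLp 2) ((hΦ.isSmooth_slice t).memLp 2)
      have iAB : Integrable (fun x => ⟪u t x, Literature.Analysis.FunctionSpaces.Torus.timeDeriv (fun t => twoHalf (0 : 𝕋² → E²) (φ t)) t x⟫_ℝ +
          ⟪u t x, Torus.convect (u t) (twoHalf (0 : 𝕋² → E²) (φ t)) x⟫_ℝ) volume := iA.add iB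
      have iABC : Integrable (fun x => ⟪u t x, Literature.Analysis.FunctionSpaces.Torus.timeDeriv (fun t => twoHalf (0 : 𝕋² → E²) (φ t)) t x⟫_ℝ +
          ⟪u t x, Torus.convect (u t) (twoHalf (0 : 𝕋² → E²) (φ t)) x⟫_ℝ +
          ν * ⟪u t x, Torus.laplacian (twoHalf (0 : 𝕋² → E²) (φ t)) x⟫_ℝ) volume := iAB.add iC
      -- integrability, 2-D side
      have jA : Integrable (fun y => verticalPart (u t) y * Literature.Analysis.FunctionSpaces.Torus.timeDeriv φ t y) volume :=
        integrable_mul_slice (w := fun t => verticalPart (u t)) hφ.continuous_uncurry_timeDeriv (hM₁ t (hIo ht)) hRt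
      have jB : Integrable (fun y => verticalPart (u t) y * ⟪planarPart (u t) y, Torus.gradient (φ t) y⟫_ℝ) volume :=
        integrable_mul_inner_gradient_slice (u := fun t => planarPart (u t)) (w := fun t => verticalPart (u t)) hφ hVt hRt
      have jC : Integrable (fun y => ν * (verticalPart (u t) y * Torus.laplacian (φ t) y)) volume :=
        (integrable_mul_slice (w := fun t => verticalPart (u t)) hφ.continuous_uncurry_laplacian (hM₂ t (hIo ht)) hRt).const_mul ν
      have jAB : Integrable (fun y => verticalPart (u t) y * Literature.Analysis.FunctionSpaces.Torus.timeDeriv φ t y +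
          verticalPart (u t) y * ⟪planarPart (u t) y, Torus.gradient (φ t) y⟫_ℝ) volume := jA.add jB
      -- descended terms
      have eA : ∫ x, ⟪u t x, Literature.Analysis.FunctionSpaces.Torus.timeDeriv (fun t => twoHalf (0 : 𝕋² → E²) (φ t)) t x⟫_ℝ =
          ∫ y, verticalPart (u t) y * Literature.Analysis.FunctionSpaces.Torus.timeDeriv φ t y := by
        rw [timeDeriv_vlift hφ t]
        exact integral_inner_vlift (hinv t) hut ((hφ.timeDeriv.isSmooth_slice t).memLp 2)
      have eB := integral_inner_convect_vlift hφ t (hinv t) hut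
      have eC : ∫ x, ν * ⟪u t x, Torus.laplacian (twoHalf (0 : 𝕋² → E²) (φ t)) x⟫_ℝ =
          ∫ y, ν * (verticalPart (u t) y * Torus.laplacian (φ t) y) := by
        rw [integral_const_mul, integral_const_mul, integral_inner_laplacian_vlift (hinv t) hut (hφ.isSmooth_slice t)]
      have eD : ∫ x, ⟪twoHalf g h x, twoHalf (0 : 𝕋² → E²) (φ t) x⟫_ℝ = ∫ y, h y * φ t y :=
        integral_inner_force_vlift (hh.memLp 2) ((hφ.isSmooth_slice t).memLp 2)
      -- expand the 2-D integrand
      have hexp : (∫ y, verticalPart (u t) y *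
            (Literature.Analysis.FunctionSpaces.Torus.timeDeriv φ t y + ⟪planarPart (u t) y, Torus.gradient (φ t) y⟫_ℝ +
              ν * Torus.laplacian (φ t) y)) =
          ∫ y, (verticalPart (u t) y * Literature.Analysis.FunctionSpaces.Torus.timeDeriv φ t y +
            verticalPart (u t) y * ⟪planarPart (u t) y, Torus.gradient (φ t) y⟫_ℝ +
            ν * (verticalPart (u t) y * Torus.laplacian (φ t) y)) :=
        integral_congr_ae (ae_of_all _ fun y => by ring)
      show (∫ x, (⟪u t x, Literature.Analysis.FunctionSpaces.Torus.timeDeriv (fun t => twoHalf (0 : 𝕋² → E²) (φ t)) t x⟫_ℝ +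
            ⟪u t x, Torus.convect (u t) (twoHalf (0 : 𝕋² → E²) (φ t)) x⟫_ℝ +
            ν * ⟪u t x, Torus.laplacian (twoHalf (0 : 𝕋² → E²) (φ t)) x⟫_ℝ +
            ⟪twoHalf g h x, twoHalf (0 : 𝕋² → E²) (φ t) x⟫_ℝ)) =
          (∫ y, verticalPart (u t) y *
              (Literature.Analysis.FunctionSpaces.Torus.timeDeriv φ t y + ⟪planarPart (u t) y, Torus.gradient (φ t) y⟫_ℝ +
                ν * Torus.laplacian (φ t) y)) +
            ∫ y, h y * φ t y
      rw [hexp, integral_add iABC iD, integral_add iAB iC, integral_add iA iB, integral_add jAB jC, integral_add jA jB,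
        eA, eB, eC, eD]
    -- time integrability of the two 2-D pieces
    have K₁ : IntegrableOn (fun t => ∫ y, verticalPart (u t) y * Literature.Analysis.FunctionSpaces.Torus.timeDeriv φ t y) (Ioo 0 T) :=
      integrableOn_integral_mul (w := fun t => verticalPart (u t)) hφ.continuous_uncurry_timeDeriv hwm hR2 hCw
    have K₂ : IntegrableOn (fun t => ∫ y, verticalPart (u t) y * ⟪planarPart (u t) y, Torus.gradient (φ t) y⟫_ℝ) (Ioo 0 T) :=
      integrableOn_integral_mul_inner_gradient (u := fun t => planarPart (u t)) (w := fun t => verticalPart (u t)) hφ hum hwm hV2 hR2 hCu hCw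
    have K₃ : IntegrableOn (fun t => ∫ y, ν * (verticalPart (u t) y * Torus.laplacian (φ t) y)) (Ioo 0 T) := by
      have K := integrableOn_integral_mul (w := fun t => verticalPart (u t)) hφ.continuous_uncurry_laplacian hwm hR2 hCw
      have heq : (fun t => ∫ y, ν * (verticalPart (u t) y * Torus.laplacian (φ t) y)) =
          fun t => ν * ∫ y, verticalPart (u t) y * Torus.laplacian (φ t) y := by
        funext t
        exact integral_const_mul _ _
      rw [heq]
      exact K.const_mul ν
    have hhm : AEStronglyMeasurable (uncurry fun (_ : ℝ) => h) ((volume.restrict (Ioo 0 T)).prod (volume : Measure 𝕋²)) :=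
      (hh.continuous.comp continuous_snd).aestronglyMeasurable
    have K₄ : IntegrableOn (fun t => ∫ y, h y * φ t y) (Ioo 0 T) :=
      integrableOn_integral_mul (w := fun _ => h) hφ.continuous_uncurry hhm (fun _ _ => hh.memLp 2) (fun _ _ => le_rfl)
    -- the time integral of the expanded slice integrand
    have Kexp : ∀ t ∈ Ioo 0 T, (∫ y, verticalPart (u t) y *
          (Literature.Analysis.FunctionSpaces.Torus.timeDeriv φ t y + ⟪planarPart (u t) y, Torus.gradient (φ t) y⟫_ℝ +
            ν * Torus.laplacian (φ t) y)) =
        (∫ y, verticalPart (u t) y * Literature.Analysis.FunctionSpaces.Torus.timeDeriv φ t y) +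
          (∫ y, verticalPart (u t) y * ⟪planarPart (u t) y, Torus.gradient (φ t) y⟫_ℝ) +
          ∫ y, ν * (verticalPart (u t) y * Torus.laplacian (φ t) y) := by
      intro t ht
      have hRt := hR2 t ht
      have hVt := hV2 t ht
      have jA : Integrable (fun y => verticalPart (u t) y * Literature.Analysis.FunctionSpaces.Torus.timeDeriv φ t y) volume :=
        integrable_mul_slice (w := fun t => verticalPart (u t)) hφ.continuous_uncurry_timeDeriv (hM₁ t (hIo ht)) hRt
      have jB : Integrable (fun y => verticalPart (u t) y * ⟪planarPart (u t) y, Torus.gradient (φ t) y⟫_ℝ) volume :=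
        integrable_mul_inner_gradient_slice (u := fun t => planarPart (u t)) (w := fun t => verticalPart (u t)) hφ hVt hRt
      have jC : Integrable (fun y => ν * (verticalPart (u t) y * Torus.laplacian (φ t) y)) volume :=
        (integrable_mul_slice (w := fun t => verticalPart (u t)) hφ.continuous_uncurry_laplacian (hM₂ t (hIo ht)) hRt).const_mul ν
      have jAB : Integrable (fun y => verticalPart (u t) y * Literature.Analysis.FunctionSpaces.Torus.timeDeriv φ t y +
          verticalPart (u t) y * ⟪planarPart (u t) y, Torus.gradient (φ t) y⟫_ℝ) volume := jA.add jB
      have hexp : (∫ y, verticalPart (u t) y *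
            (Literature.Analysis.FunctionSpaces.Torus.timeDeriv φ t y + ⟪planarPart (u t) y, Torus.gradient (φ t) y⟫_ℝ +
              ν * Torus.laplacian (φ t) y)) =
          ∫ y, (verticalPart (u t) y * Literature.Analysis.FunctionSpaces.Torus.timeDeriv φ t y +
            verticalPart (u t) y * ⟪planarPart (u t) y, Torus.gradient (φ t) y⟫_ℝ +
            ν * (verticalPart (u t) y * Torus.laplacian (φ t) y)) :=
        integral_congr_ae (ae_of_all _ fun y => by ring)
      rw [hexp, integral_add jAB jC, integral_add jA jB]
    have KX : IntegrableOn (fun t => ∫ y, verticalPart (u t) y *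
          (Literature.Analysis.FunctionSpaces.Torus.timeDeriv φ t y + ⟪planarPart (u t) y, Torus.gradient (φ t) y⟫_ℝ +
            ν * Torus.laplacian (φ t) y)) (Ioo 0 T) := by
      have K123 : IntegrableOn (fun t => (∫ y, verticalPart (u t) y * Literature.Analysis.FunctionSpaces.Torus.timeDeriv φ t y) +
          (∫ y, verticalPart (u t) y * ⟪planarPart (u t) y, Torus.gradient (φ t) y⟫_ℝ) +
          ∫ y, ν * (verticalPart (u t) y * Torus.laplacian (φ t) y)) (Ioo 0 T) := (K₁.add K₂).add K₃
      exact K123.congr_fun (fun t ht => (Kexp t ht).symm) measurableSet_Ioo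
    -- datum
    have hdatum : ∫ x, ⟪u₀ x, (fun t => twoHalf (0 : 𝕋² → E²) (φ t)) 0 x⟫_ℝ = ∫ y, verticalPart u₀ y * φ 0 y :=
      integral_inner_vlift hinv₀ h2₀ ((hφ.isSmooth_slice 0).memLp 2)
    rw [setIntegral_congr_fun measurableSet_Ioo hslice, integral_add KX K₄, hdatum] at h3
    -- `h3 : (∫X + ∫Y) + datum = 0`; the goal is `∫X' + ∫Y + datum = 0` with `X' = X` up to the source written as `(fun _ => h) t`
    simpa [add_assoc] using h3

end ScalarDescent

end Summit.AnomalousDissipation.AnomalousDissipation.Theorems.TwohalfdThesis.Negative.Descent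

end
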